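import Literature.NumberTheory.Automorphic.PicardCMUniverse
import Literature.AlgebraicGeometry.HodgeTheory.BettiUniverseCMAction
import Literature.AlgebraicGeometry.HodgeTheory.AlgebraicClassesHodgeTypeHolds
import Literature.AlgebraicGeometry.HodgeTheory.LefschetzOneOneHolds
import Literature.AlgebraicGeometry.HodgeTheory.AlgebraicClassesCupDivisorHolds
import Summits.HodgeConjecture.HodgeConjecture.Theorems.BoundaryReadoutPullbackAlgebraic
import HarnessLib

/-!
# COR-CM model layer, part 1: the cycle-class facts of the Picard–CM model universe

Cell `pub-hodgecm2` (COR-CM; HOME `run/shared/lean/pub/pub-hodgecm2/`), seat `model-1`.  Stage 1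
(`pub-hodgecm`, package `HodgeCMPerL`) states 28 standard facts `HodgeCM.Universe.Fact_…` about a
geometric universe `U : HodgeCM.Universe` (`HodgeCM/Geometry/Facts.lean`, record `ModelAxioms` l.263) and
builds the Picard–CM model universe `HodgeCM.Model.universeOf hHD hI hU h₃` (`HodgeCM/Model/Universe.lean`
l.117) out of the TREE objects `PicardCM.Var`, `PicardCM.Var.scheme/Coh/alg/Mor`, `BettiUniverse.pull/cup/
hodge/tr`, `BettiUniverse.cmEndAction` (files `Literature/NumberTheory/Automorphic/PicardCMUniverse.lean`,
`Literature/AlgebraicGeometry/HodgeTheory/BettiUniverse{Axioms,CMAction}.lean`).  Stage 1 discharged on that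
model only the five facts of the PerL cone (`ModelAxiomsPerL`) plus `tr_degree`, `hodgeRiemann20`, `H1_rank`,
`cmAV`.  Of the 28 facts, 17 are read only on the COR-CM side (stage-1 `MODEL-SCOPE.md` A.2 O6, l.88):
`tr_degree, alg_le_hodge, pull_alg, cup_alg, lefschetz11, cmDominated, weilLine_rank, weilLine_hodge, lift,
cup_interchange, kunneth1, H4_span, cmEnd, conjIsogeny, gysin_surface, deg_diag, algDuality`.

THIS FILE proves, over the tree objects the model universe is made of, the seven of them that are
kernel theorems of the tree TODAY (verdict table: HOME `pub-hodgecm2-model-1/MODEL-SCOPE-CORCM.md`):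

| stage-1 fact (row of stage-1 `FACTS.md` §1; line in `Facts.lean`) | statement on the model | tree theorem used |
|---|---|---|
| M6 `Fact_alg_le_hodge` (l.63) | `ratAlgebraicClasses X p ≤ Hdgᵖ(hodge hHD hX (2p))` | `isOfHodgeType_of_mem_algebraicClasses_of_isSmoothProjective` (Voisin I Prop. 11.20) |
| M7 `Fact_pull_alg` (l.66) | `f^*` maps rational algebraic classes to rational algebraic classes | `Summit…Theorems.fulton1998_map_mem_algebraicClasses_holds` (Fulton Cor. 19.2 (b)) |
| M8 `Fact_cup_alg` (l.72) | cup of two rational divisor classes is rational algebraic | `cupProduct_mem_algebraicClasses_of_min_le_one` (Voisin II Prop. 9.20) |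
| M9 `Fact_Lefschetz11` (l.77) | `Hdg¹(hodge hHD hX 2) ≤ ratAlgebraicClasses X 1` | `lefschetzOneOne_rational_holds` (Voisin I Thm. 11.30) |
| M18 `Fact_lift` (l.148) | morphisms `Z ⟶ X`, `Z ⟶ Y` factor through `X ⊗ Y` | Mathlib `CartesianMonoidalCategory.lift` |
| M20 `Fact_cup_interchange` (l.159) | `(a ∪ b) ∪ (c ∪ d) = -((a ∪ c) ∪ (b ∪ d))` on `H¹` | `BettiUniverse.cup_interchange_one` (Hatcher Thm. 3.11) |
| M24 `Fact_cmEnd` (l.185) | every `a ∈ 𝓞_K` acts on the realised `A_{(K,Φ)}` by a morphism with `f^* = ι(a)` on `H¹(ℚ)` | `CMRealisation.exists_map_comp`, `BettiUniverse.ofRatClass_cmAction` |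

(`M5 Fact_tr_degree` is `BettiUniverse.tr_of_ne`, already instantiated by stage 1 as `HodgeCM.Model.tr_degree`;
the PerL-path facts `pull_id`, `cup_comm1` are `BettiUniverse.pull_id`, `BettiUniverse.cup_comm_one`.)

Each theorem is stated (§1–§2) for an arbitrary smooth projective `X : Motives.SchemeOver ℂ`, resp. an
arbitrary realisation `R : PicardCM.CMRealisation c` of a CM code, and then (§3) in the literal shape of the
package fact on the index type `PicardCM.Var` under the model's hypotheses `hHD hI hU h₃`, so that the
package-side instantiation `(universeOf hHD hI hU h₃).Fact_… ` is a one-line application (the package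
cannot import the tree; it vendors these files, stage-1 MANIFEST).  Bridge lemmas proved here and reused by
the later parts of the layer: `mem_hodgeClasses_hodge_iff` (Hodge classes of `BettiUniverse.hodge` = rational
classes of type `(p,p)`, over `hI`), `ofRatClass_pull` and `ofRatClass_cup` (the rational lattice
`Hᵏ(X(ℂ);ℚ) → Hᵏ(X(ℂ);ℂ)` commutes with pull-back and cup product).

Not here (later parts / other verdicts): `kunneth1`, `H4_span`, `weilLine_hodge`, `weilLine_rank`
(KERNEL-medium: Künneth `complexBetti_kunneth_bijective`, `abelianVarietyCohomologyExteriorH1_holds`, eigenline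
Hodge types of the record (iii), `ℚ`-descent); `cmDominated`, `conjIsogeny`, `gysin_surface`, `deg_diag`,
`algDuality` (PRINT records: Shimura–Taniyama uniqueness up to isogeny, Gysin/projection formula, Lieberman 1968).
No statement of the summit or of a route is touched; nothing here is cited as a published fact — every
declaration is a theorem of the tree's existing theorems.
-/

noncomputable section

open CategoryTheory MonoidalCategory
open NumberField
open Literature.AlgebraicTopology.SingularHomology (cupProduct singularCohomology)
open Literature.AlgebraicGeometry.Motives (SchemeOver ComplexPoints IsSmoothProjective bettiCohomology)
open Literature.AlgebraicGeometry.HodgeTheory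
open Literature.NumberTheory.Automorphic.PicardCM

namespace Summit.HodgeConjecture.CorCM.Model

/-! ### §1 Rational algebraic classes versus the Hodge structure `BettiUniverse.hodge` -/

section General

variable {n m : ℕ} {X Y : SchemeOver ℂ}

/-- **Hodge classes of `BettiUniverse.hodge hHD hX (2p)` are the rational classes of type `(p,p)`**
(the tree's `HodgeModel.mem_hodgeClasses_iff_isOfHodgeType` read in the model's chosen real Hodge model;
over `hI`, independent of that choice). -/
theorem mem_hodgeClasses_hodge_iff (hHD : exists_isReal_hodgeModel)
    (hI : hodgePQ_independent_of_hodgeModel) (hX : IsSmoothProjective n X) (p : ℕ)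
    (v : bettiCohomology X (2 * p)) :
    v ∈ (BettiUniverse.hodge hHD hX (2 * p)).hodgeClasses p ↔
      IsOfHodgeType n X (2 * p) p p (ofRatClass (ComplexPoints X) (2 * p) v) :=
  (BettiUniverse.realHodgeModel hHD hX).mem_hodgeClasses_iff_isOfHodgeType hX hI
    (BettiUniverse.realHodgeModel_isHodgeSymmetric hHD hX) p v

/-- **M6 `alg_le_hodge` on the model**: rational algebraic classes are Hodge classes of
`BettiUniverse.hodge` (Voisin I Prop. 11.20, the tree's `isOfHodgeType_of_mem_algebraicClasses_of_isSmoothProjective`). -/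
theorem ratAlgebraicClasses_le_hodgeClasses (hHD : exists_isReal_hodgeModel)
    (hI : hodgePQ_independent_of_hodgeModel) (hX : IsSmoothProjective n X) (p : ℕ) :
    ratAlgebraicClasses X p ≤ (BettiUniverse.hodge hHD hX (2 * p)).hodgeClasses p := fun v hv ↦
  (mem_hodgeClasses_hodge_iff hHD hI hX p v).2
    (isOfHodgeType_of_mem_algebraicClasses_of_isSmoothProjective hX p
      ((mem_ratAlgebraicClasses_iff X p v).1 hv))

/-- **M9 `lefschetz11` on the model**: Hodge classes of degree `2` of `BettiUniverse.hodge` are rational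
algebraic classes (Lefschetz (1,1), the tree's `lefschetzOneOne_rational_holds`). -/
theorem hodgeClasses_one_le_ratAlgebraicClasses (hHD : exists_isReal_hodgeModel)
    (hI : hodgePQ_independent_of_hodgeModel) (hX : IsSmoothProjective n X) :
    (BettiUniverse.hodge hHD hX (2 * 1)).hodgeClasses 1 ≤ ratAlgebraicClasses X 1 := fun v hv ↦
  (mem_ratAlgebraicClasses_iff X 1 v).2
    (lefschetzOneOne_rational_holds hX _ (isRationalClass_ofRatClass v)
      ((mem_hodgeClasses_hodge_iff hHD hI hX 1 v).1 hv))

/-- The rational lattice commutes with pull-back: `(f^* v) ⊗ 1 = f^*(v ⊗ 1)`. -/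
theorem ofRatClass_pull (f : X ⟶ Y) (k : ℕ) (v : bettiCohomology Y k) :
    ofRatClass (ComplexPoints X) k (BettiUniverse.pull f k v) =
      complexBetti.map f k (ofRatClass (ComplexPoints Y) k v) :=
  Literature.AlgebraicGeometry.Motives.ofRatClass_map k _ v

/-- **M7 `pull_alg` on the model**: pull-back along a morphism of smooth projective varieties maps rational
algebraic classes to rational algebraic classes (Fulton Cor. 19.2 (b), the tree's
`fulton1998_map_mem_algebraicClasses_holds`). -/
theorem ratAlgebraicClasses_map_pull_le (hY : IsSmoothProjective m Y) (hX : IsSmoothProjective n X)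
    (f : X ⟶ Y) (p : ℕ) :
    (ratAlgebraicClasses Y p).map (BettiUniverse.pull f (2 * p)) ≤ ratAlgebraicClasses X p := by
  rintro _ ⟨v, hv, rfl⟩
  rw [SetLike.mem_coe, mem_ratAlgebraicClasses_iff] at hv
  rw [mem_ratAlgebraicClasses_iff, ofRatClass_pull]
  exact Summit.HodgeConjecture.HodgeConjecture.Theorems.fulton1998_map_mem_algebraicClasses_holds f hY hX
    p _ hv

/-- The rational lattice is multiplicative: `(x ∪ y) ⊗ 1 = (x ⊗ 1) ∪ (y ⊗ 1)`. -/
theorem ofRatClass_cup (i j : ℕ) (x : bettiCohomology X i) (y : bettiCohomology X j) :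
    ofRatClass (ComplexPoints X) (i + j) (BettiUniverse.cup X i j x y) =
      cupProduct rfl (ofRatClass (ComplexPoints X) i x) (ofRatClass (ComplexPoints X) j y) := by
  rw [ofRatClass_eq_ringChange, ofRatClass_eq_ringChange, ofRatClass_eq_ringChange,
    singularCohomology.ringChange_cupProduct]

/-- **M8 `cup_alg` on the model**: the cup product of two rational divisor classes is a rational algebraic
class of codimension `2` (Voisin II Prop. 9.20, the tree's `cupProduct_mem_algebraicClasses_of_min_le_one`). -/
theorem cup_mem_ratAlgebraicClasses_two (hX : IsSmoothProjective n X) {x y : bettiCohomology X 2}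
    (hx : x ∈ ratAlgebraicClasses X 1) (hy : y ∈ ratAlgebraicClasses X 1) :
    BettiUniverse.cup X 2 2 x y ∈ ratAlgebraicClasses X 2 := by
  rw [mem_ratAlgebraicClasses_iff] at hx hy
  refine (mem_ratAlgebraicClasses_iff X 2 _).2 ?_
  have e : ofRatClass (ComplexPoints X) (2 * 2) (BettiUniverse.cup X 2 2 x y) =
      cupProduct (two_mul_add_two_mul 1 1) (ofRatClass (ComplexPoints X) 2 x)
        (ofRatClass (ComplexPoints X) 2 y) :=
    ofRatClass_cup 2 2 x y
  rw [e]
  exact cupProduct_mem_algebraicClasses_of_min_le_one hX (l := 1) (k := 1) (Or.inl le_rfl) hx hy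

/-- **M18 `lift` on the model**: the universal property of the product `X ⊗ Y` in `SchemeOver ℂ`
(existence half). -/
theorem exists_lift (X Y Z : SchemeOver ℂ) (f : Z ⟶ X) (g : Z ⟶ Y) :
    ∃ h : Z ⟶ X ⊗ Y, h ≫ CartesianMonoidalCategory.fst X Y = f ∧
      h ≫ CartesianMonoidalCategory.snd X Y = g :=
  ⟨CartesianMonoidalCategory.lift f g, CartesianMonoidalCategory.lift_fst f g,
    CartesianMonoidalCategory.lift_snd f g⟩

end General

/-! ### §2 The CM action of a realised CM code is induced by endomorphisms on the integers -/

section CM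

variable {c : CMCode}

/-- **M24 `cmEnd` on a realisation**: for a realisation `R` of a CM code `c = (E, Φ)`, an abstract field
`K ≃+* E` and `a ∈ 𝓞_K`, some endomorphism `f : A ⟶ A` of the realised variety has rational pull-back
`f^* = ι(a)` on `H¹(A(ℂ); ℚ)`, `ι` the rational CM action `BettiUniverse.cmEndAction` descended from `R.θ ∘ e`
(both sides have the same complexification `θ(e a)`; the rational lattice is injective). -/
theorem exists_pull_eq_cmEndAction (hHD : exists_isReal_hodgeModel)
    (hI : hodgePQ_independent_of_hodgeModel) (R : CMRealisation c) {K : Type} [Field K] [NumberField K]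
    (e : K ≃+* c.E) (a : 𝓞 K) :
    ∃ f : R.A ⟶ R.A, BettiUniverse.pull f 1 =
      (BettiUniverse.cmEndAction (R.θ.comp e.toRingHom) (R.exists_map_comp e) hHD hI
        R.isSmoothProjective).ι (a : K) := by
  obtain ⟨f, hf⟩ := R.exists_map_comp e a
  refine ⟨f, LinearMap.ext fun v ↦ ofRatClass_injective 1 ?_⟩
  rw [BettiUniverse.cmEndAction_ι, ofRatClass_pull, BettiUniverse.ofRatClass_cmAction, ← hf]

end CM

/-! ### §3 The same facts in the shape of the package's `Fact_…`, on the index type `PicardCM.Var` -/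

section PicardCMVar

/-! The four hypotheses of the stage-1 model universe `universeOf hHD hI hU h₃`, as explicit binders of each
statement: `hHD : exists_isReal_hodgeModel` and `hI : hodgePQ_independent_of_hodgeModel` are THEOREMS of the
tree (`exists_isReal_hodgeModel_holds`, `hodgePQ_independent_of_hodgeModel_holds`, both in this file's import
cone; the package keeps them as binders only to keep its vendored import cone light, and any two proofs give
definitionally equal model fields), while `hU : BallQuotientUniformisedDatum` and
`h₃ : CMAbelianVarietyRealised` are the two cited records (ii), (iii) of `PicardCMPrerequisites` under which the
model's varieties are realised. -/

/-- `Fact_tr_degree` of the model (= `BettiUniverse.tr_of_ne`; stage-1 `HodgeCM.Model.tr_degree`). -/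
theorem var_tr_degree (hU : BallQuotientUniformisedDatum) (h₃ : CMAbelianVarietyRealised) (v : Var) (k : ℕ)
    (hk : k ≠ 2 * v.dim) : BettiUniverse.tr (Var.isSmoothProjective hU h₃ v) k = 0 :=
  BettiUniverse.tr_of_ne (Var.isSmoothProjective hU h₃ v) hk

/-- `Fact_alg_le_hodge` of the model. -/
theorem var_alg_le_hodgeClasses (hHD : exists_isReal_hodgeModel) (hI : hodgePQ_independent_of_hodgeModel)
    (hU : BallQuotientUniformisedDatum) (h₃ : CMAbelianVarietyRealised) (v : Var) (p : ℕ) :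
    Var.alg hU h₃ v p ≤ (BettiUniverse.hodge hHD (Var.isSmoothProjective hU h₃ v) (2 * p)).hodgeClasses p :=
  ratAlgebraicClasses_le_hodgeClasses hHD hI (Var.isSmoothProjective hU h₃ v) p

/-- `Fact_pull_alg` of the model. -/
theorem var_pull_alg (hU : BallQuotientUniformisedDatum) (h₃ : CMAbelianVarietyRealised) (v w : Var)
    (f : Var.Mor hU h₃ v w) (p : ℕ) :
    (Var.alg hU h₃ w p).map (BettiUniverse.pull f (2 * p)) ≤ Var.alg hU h₃ v p :=
  ratAlgebraicClasses_map_pull_le (Var.isSmoothProjective hU h₃ w) (Var.isSmoothProjective hU h₃ v) f p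

/-- `Fact_cup_alg` of the model. -/
theorem var_cup_alg (hU : BallQuotientUniformisedDatum) (h₃ : CMAbelianVarietyRealised) (v : Var)
    (x y : Var.Coh hU h₃ v 2) (hx : x ∈ Var.alg hU h₃ v 1) (hy : y ∈ Var.alg hU h₃ v 1) :
    BettiUniverse.cup (Var.scheme hU h₃ v) 2 2 x y ∈ Var.alg hU h₃ v 2 :=
  cup_mem_ratAlgebraicClasses_two (Var.isSmoothProjective hU h₃ v) hx hy

/-- `Fact_Lefschetz11` of the model. -/
theorem var_lefschetz11 (hHD : exists_isReal_hodgeModel) (hI : hodgePQ_independent_of_hodgeModel)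
    (hU : BallQuotientUniformisedDatum) (h₃ : CMAbelianVarietyRealised) (v : Var) :
    (BettiUniverse.hodge hHD (Var.isSmoothProjective hU h₃ v) (2 * 1)).hodgeClasses 1 ≤ Var.alg hU h₃ v 1 :=
  hodgeClasses_one_le_ratAlgebraicClasses hHD hI (Var.isSmoothProjective hU h₃ v)

/-- `Fact_lift` of the model. -/
theorem var_lift (hU : BallQuotientUniformisedDatum) (h₃ : CMAbelianVarietyRealised) (v w z : Var)
    (f : Var.Mor hU h₃ z v) (g : Var.Mor hU h₃ z w) :
    ∃ h : Var.Mor hU h₃ z (Var.prod v w), Var.comp hU h₃ h (Var.fst hU h₃ v w) = f ∧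
      Var.comp hU h₃ h (Var.snd hU h₃ v w) = g :=
  exists_lift _ _ _ f g

/-- `Fact_cup_interchange` of the model (= `BettiUniverse.cup_interchange_one`). -/
theorem var_cup_interchange (hU : BallQuotientUniformisedDatum) (h₃ : CMAbelianVarietyRealised) (v : Var)
    (a b c d : Var.Coh hU h₃ v 1) :
    BettiUniverse.cup (Var.scheme hU h₃ v) 2 2 (BettiUniverse.cup _ 1 1 a b) (BettiUniverse.cup _ 1 1 c d) =
      -(BettiUniverse.cup (Var.scheme hU h₃ v) 2 2 (BettiUniverse.cup _ 1 1 a c)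
        (BettiUniverse.cup _ 1 1 b d)) :=
  BettiUniverse.cup_interchange_one a b c d

/-- `Fact_pull_id` of the model (= `BettiUniverse.pull_id`; PerL-path fact, recorded for completeness). -/
theorem var_pull_id (hU : BallQuotientUniformisedDatum) (h₃ : CMAbelianVarietyRealised) (v : Var) (k : ℕ) :
    BettiUniverse.pull (Var.idMor hU h₃ v) k = LinearMap.id :=
  BettiUniverse.pull_id _ k

/-- `Fact_cup_comm1` of the model (= `BettiUniverse.cup_comm_one`; PerL-path fact, recorded for completeness). -/
theorem var_cup_comm1 (hU : BallQuotientUniformisedDatum) (h₃ : CMAbelianVarietyRealised) (v : Var)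
    (a b : Var.Coh hU h₃ v 1) :
    BettiUniverse.cup (Var.scheme hU h₃ v) 1 1 a b = -(BettiUniverse.cup (Var.scheme hU h₃ v) 1 1 b a) :=
  BettiUniverse.cup_comm_one a b

/-- `Fact_cmEnd` of the model: for the CM abelian variety `Var.cm c` of a code and any abstract field
`K ≃+* c.E` (the package takes `K` a CM field, `c := cmCode K Φ`, `e := cmCodeEquiv K Φ`), every `a ∈ 𝓞_K`
acts by an endomorphism whose rational pull-back on `H¹` is the model's `cmAct` (`BettiUniverse.cmEndAction`
of `θ ∘ e`). -/
theorem var_cmEnd (hHD : exists_isReal_hodgeModel) (hI : hodgePQ_independent_of_hodgeModel)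
    (hU : BallQuotientUniformisedDatum) (h₃ : CMAbelianVarietyRealised) (c : CMCode) {K : Type} [Field K]
    [NumberField K] (e : K ≃+* c.E) (a : 𝓞 K) :
    ∃ f : Var.Mor hU h₃ (.cm c) (.cm c), BettiUniverse.pull f 1 =
      (BettiUniverse.cmEndAction ((cmRealisation h₃ c).θ.comp e.toRingHom)
        ((cmRealisation h₃ c).exists_map_comp e) hHD hI (Var.isSmoothProjective hU h₃ (.cm c))).ι (a : K) :=
  exists_pull_eq_cmEndAction hHD hI (cmRealisation h₃ c) e a

end PicardCMVar

end Summit.HodgeConjecture.CorCM.Model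

end
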